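import Summits.ABC.ABC.Theses.IneffectiveSubspace

/-!
# `UniformSadicTowerFour` (stmt-ABC-14937), line `Sketch`: the `K`-uniform sandwich `stub_uniformInK_iff_abc`

The line puts the crux in mixed-radical normal form on abc triples: `c < C(K, ε) · M_S(abc)^(1+ε)` for
every abc triple `(a, b, c)` and every set `S` of at most `K` primes, where the mixed radical

  `M_S(m) := (∏_{p ∈ S} p) · ∏_{p ∈ m.primeFactors \ S} p^⌈v_p(m)/4⌉`,   `⌈v/4⌉ = (v + 3) / 4`,

charges `p` on `S` and the 4-rounded radical off `S`. This file is the `K`-UNIFORM SANDWICH: if the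
constant does not depend on `K` — i.e. the inequality holds for EVERY finite set of primes `S` with a
single `C(ε)` — then the statement is exactly `ABC`, and conversely.

Proof sketch.
* `→`: given `ε` take `C` from the hypothesis; for an abc triple choose `S := (abc).primeFactors` (a set
  of primes). Then `(abc).primeFactors \ S = ∅`, so the second product is `1`, and
  `∏_{p ∈ S} p = radical(abc) = rad(a, b, c)` (`Nat.radical_eq_prod_primeFactors`, `rad_def`): the
  hypothesis becomes abc verbatim (`uniformInK_mixed_self`).
* `←`: `ABC` gives `c < C · rad(abc)^(1+ε)`, and `rad(abc) ≤ M_S(abc)` in `ℕ` for every finite set of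
  primes `S` (`uniformInK_rad_le_mixed`): `radical(abc) = (∏_{PF ∩ S} p) · (∏_{PF \ S} p)`, the first
  factor divides `∏_{p ∈ S} p`, the second divides `∏_{PF \ S} p^{(v_p + 3)/4}` termwise since `v_p ≥ 1`
  on prime factors, and `M_S(abc) > 0` because `S` consists of primes; finish by monotonicity of
  `t ↦ C · t^(1+ε)`.

Sources: card mixed-radical-exchange-map (crux stmt-ABC-14937, line Sketch). Mathlib only
(`Nat.radical_eq_prod_primeFactors`, `Finset.prod_inter_mul_prod_sdiff`, `Finset.prod_dvd_prod_of_subset`,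
`Finset.prod_dvd_prod_of_dvd`, `Nat.le_of_dvd`, `Real.rpow_le_rpow` via `gcongr`) and the root
regression lemma `ABC_iff`. No new definitions; nothing conditional. Deliberately NOT here: the other
stubs of the line (the `S`-wise normal form, PLACES → LEVEL, the `ω ≤ 2` corner, the Hall rung, the
open core).
-/

-- `Summit.<Summit>.<Problem>` is the mandated summit-side namespace (CONVENTIONS §2); for the
-- single-conjunct summit `ABC` the two coincide, so the duplicate `ABC.ABC` is deliberate.
set_option linter.dupNamespace false

namespace Summit.ABC.ABC.Theorems.UniformSadicTowerFour.MixedRadical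

open Literature.NumberTheory.DiophantineGeometry (IsABCTriple rad rad_def)
open Summit.ABC.ABC.Theses.IneffectiveSubspace
open scoped BigOperators

/-- For any `M` and any finite `S ⊆ ℕ`, the radical of `M` divides the mixed radical
`(∏_{p ∈ S} p) · ∏_{p ∈ M.primeFactors \ S} p^{(v_p(M) + 3)/4}`: split `∏_{p ∈ M.primeFactors} p`
along `S`; the part inside `S` divides `∏_{p ∈ S} p`, and off `S` each prime factor `p` of `M`
divides `p^{(v_p(M) + 3)/4}` since `v_p(M) ≥ 1` makes the exponent `≥ 1`. [folklore] -/
theorem uniformInK_radical_dvd_mixed (M : ℕ) (S : Finset ℕ) :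
    UniqueFactorizationMonoid.radical M ∣
      (∏ p ∈ S, p) * ∏ p ∈ M.primeFactors \ S, p ^ ((M.factorization p + 3) / 4) := by
  rw [Nat.radical_eq_prod_primeFactors, ← Finset.prod_inter_mul_prod_sdiff M.primeFactors S]
  refine mul_dvd_mul ?_ ?_
  · exact Finset.prod_dvd_prod_of_subset _ _ _ Finset.inter_subset_right
  · refine Finset.prod_dvd_prod_of_dvd _ _ fun p hp => ?_
    obtain ⟨hp, hdvd, hM⟩ := Nat.mem_primeFactors.mp (Finset.mem_sdiff.mp hp).1
    refine dvd_pow_self p ?_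
    have hv := hp.factorization_pos_of_dvd hM hdvd
    omega

/-- If `S` consists of primes then the mixed radical
`(∏_{p ∈ S} p) · ∏_{p ∈ M.primeFactors \ S} p^{(v_p(M) + 3)/4}` is positive. [folklore] -/
theorem uniformInK_mixed_pos (M : ℕ) (S : Finset ℕ) (hS : ∀ p ∈ S, Nat.Prime p) :
    0 < (∏ p ∈ S, p) * ∏ p ∈ M.primeFactors \ S, p ^ ((M.factorization p + 3) / 4) := by
  refine Nat.mul_pos (Finset.prod_pos fun p hp => (hS p hp).pos) ?_
  exact Finset.prod_pos fun p hp =>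
    pow_pos (Nat.pos_of_mem_primeFactors (Finset.mem_sdiff.mp hp).1) _

/-- `rad(a, b, c) ≤ M_S(abc) = (∏_{p ∈ S} p) · ∏_{p ∈ (abc).primeFactors \ S} p^{(v_p(abc) + 3)/4}`
for every finite set of primes `S`: `rad(a, b, c) = radical(abc)` divides the (positive) mixed
radical. [folklore] -/
theorem uniformInK_rad_le_mixed (a b c : ℕ) (S : Finset ℕ) (hS : ∀ p ∈ S, Nat.Prime p) :
    rad a b c ≤ (∏ p ∈ S, p) *
      ∏ p ∈ (a * b * c).primeFactors \ S, p ^ (((a * b * c).factorization p + 3) / 4) := by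
  rw [rad_def]
  exact Nat.le_of_dvd (uniformInK_mixed_pos _ S hS) (uniformInK_radical_dvd_mixed _ S)

/-- At `S := (abc).primeFactors` the mixed radical is the radical on the nose:
`(abc).primeFactors \ S = ∅` kills the second product and `∏_{p ∈ S} p = radical(abc) = rad(a, b, c)`.
[folklore] -/
theorem uniformInK_mixed_self (a b c : ℕ) :
    (∏ p ∈ (a * b * c).primeFactors, p) *
        ∏ p ∈ (a * b * c).primeFactors \ (a * b * c).primeFactors,
          p ^ (((a * b * c).factorization p + 3) / 4) = rad a b c := by
  rw [Finset.sdiff_self, Finset.prod_empty, mul_one, rad_def, Nat.radical_eq_prod_primeFactors]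

/-- **stub_uniformInK_iff_abc (the `K`-uniform sandwich).** The mixed inequality with a constant
independent of `K` — i.e. for EVERY finite set of primes `S` — is `ABC` on the nose: `→` take
`S := (abc).primeFactors` (then `M_S(abc) = rad(abc)`); `←` `rad(abc) ≤ M_S(abc)` for every `S`.
[folklore] -/
theorem stub_uniformInK_iff_abc :
    (∀ ε : ℝ, 0 < ε → ∃ C : ℝ, 0 < C ∧ ∀ S : Finset ℕ, (∀ p ∈ S, Nat.Prime p) →
      ∀ a b c : ℕ, IsABCTriple a b c →
        (c : ℝ) < C * ((((∏ p ∈ S, p) *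
          ∏ p ∈ (a * b * c).primeFactors \ S, p ^ (((a * b * c).factorization p + 3) / 4) : ℕ) : ℝ)) ^
            (1 + ε)) ↔ ABC := by
  rw [ABC_iff]
  constructor
  · intro h ε hε
    obtain ⟨C, hC, hCS⟩ := h ε hε
    refine ⟨C, hC, fun a b c habc => ?_⟩
    have key := hCS (a * b * c).primeFactors (fun p hp => Nat.prime_of_mem_primeFactors hp)
      a b c habc
    rwa [uniformInK_mixed_self] at key
  · intro h ε hε
    obtain ⟨C, hC, hCabc⟩ := h ε hε
    refine ⟨C, hC, fun S hS a b c habc => ?_⟩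
    have hrad : ((rad a b c : ℕ) : ℝ) ≤
        (((∏ p ∈ S, p) *
          ∏ p ∈ (a * b * c).primeFactors \ S, p ^ (((a * b * c).factorization p + 3) / 4) : ℕ) : ℝ) := by
      exact_mod_cast uniformInK_rad_le_mixed a b c S hS
    calc (c : ℝ) < C * ((rad a b c : ℕ) : ℝ) ^ (1 + ε) := hCabc a b c habc
      _ ≤ C * ((((∏ p ∈ S, p) *
          ∏ p ∈ (a * b * c).primeFactors \ S, p ^ (((a * b * c).factorization p + 3) / 4) : ℕ) : ℝ)) ^
            (1 + ε) := by
        gcongr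

end Summit.ABC.ABC.Theorems.UniformSadicTowerFour.MixedRadical
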